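import Literature.AlgebraicGeometry.Frobenioids.Monoids
import Mathlib.Algebra.Category.MonCat.Basic
import Mathlib.CategoryTheory.Opposites
import HarnessLib

/-!
# Frobenioids I, Definition 1.1 (ii): the functors `Φ^gp` and `Φ^pf` (§0 residual of the STEP-0
# fragment; abc-iut cell, layer L1)

Mochizuki, *The geometry of Frobenioids I: the general theory*, Kyushu J. Math. **62** (2008)
293–400, §0 p. 11 ("we have natural morphisms `M → M^gp`, `M → M^pf`") and §1, Definition 1.1 (ii),
kurims text p. 19 [cite: MochizukiFrdI2008, Def. 1.1(ii)]:

> "If `Φ` is a monoid on `D`, then we shall use a superscript "gp" (respectively, "pf"; …) to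
> denote the functor obtained by assigning to `A` the monoid `Φ(A)^gp` (respectively, `Φ(A)^pf`;
> …)."

The groupification `M^gp = Algebra.GrothendieckGroup M` and the perfection `M^pf = Perfection M`
(`Monoids.lean`) are made functorial in monoid homomorphisms, and `Φ^gp`, `Φ^pf` are defined for a
contravariant functor `Φ : D → Mon` (here `Dᵒᵖ ⥤ CommMonCat`), together with the natural
transformations `Φ → Φ^gp`, `Φ → Φ^pf`. (`Φ^char` is `charFunctor` in `ElementaryFrobenioid.lean`;
`Φ^±`, `Φ^birat`, `Φ^rlf` belong with §2.) No statement of the paper is strengthened.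
-/

namespace Literature.AlgebraicGeometry.Frobenioids

open CategoryTheory

universe w v u

/-! ### Functoriality of the perfection `M^pf` -/

namespace Perfection

variable {M N P : Type w} [CommMonoid M] [CommMonoid N] [CommMonoid P]

/-- `M^pf` is functorial: `a^{1/n} ↦ f(a)^{1/n}` (FrdI §0 p. 11, "natural morphisms").
[cite: MochizukiFrdI2008, §0 p.11] -/
def map (f : M →* N) : Perfection M →* Perfection N where
  toFun := Quotient.map (fun x => (f x.1, x.2)) fun x y ⟨K, h⟩ => ⟨K, by
    show f x.1 ^ ((K : ℕ) * (y.2 : ℕ)) = f y.1 ^ ((K : ℕ) * (x.2 : ℕ))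
    rw [← map_pow, ← map_pow, h]⟩
  map_one' := by
    show mk (f 1) 1 = mk 1 1
    rw [map_one]
  map_mul' x y := by
    obtain ⟨⟨a, n⟩, rfl⟩ := mk_surjective x
    obtain ⟨⟨b, m⟩, rfl⟩ := mk_surjective y
    show mk (f (a ^ (m : ℕ) * b ^ (n : ℕ))) (n * m) = mk (f a ^ (m : ℕ) * f b ^ (n : ℕ)) (n * m)
    rw [map_mul, map_pow, map_pow]

/-- `map f` on classes. [cite: MochizukiFrdI2008, §0 p.11] -/
@[simp] theorem map_mk (f : M →* N) (a : M) (n : ℕ+) : map f (mk a n) = mk (f a) n := rfl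

/-- Naturality of `M → M^pf`. [cite: MochizukiFrdI2008, §0 p.11] -/
theorem map_comp_of (f : M →* N) : (map f).comp (of M) = (of N).comp f := rfl

/-- `map id = id`. [cite: MochizukiFrdI2008, §0 p.11] -/
theorem map_id : map (MonoidHom.id M) = MonoidHom.id (Perfection M) :=
  MonoidHom.ext fun x => by
    obtain ⟨⟨a, n⟩, rfl⟩ := mk_surjective x
    rfl

/-- `map (g ∘ f) = map g ∘ map f`. [cite: MochizukiFrdI2008, §0 p.11] -/
theorem map_comp (f : M →* N) (g : N →* P) : map (g.comp f) = (map g).comp (map f) :=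
  MonoidHom.ext fun x => by
    obtain ⟨⟨a, n⟩, rfl⟩ := mk_surjective x
    rfl

end Perfection

/-! ### Functoriality of the groupification `M^gp` -/

section Groupification

variable {M N P : Type w} [CommMonoid M] [CommMonoid N] [CommMonoid P]

/-- `M^gp` is functorial: the group homomorphism `M^gp → N^gp` induced by `f : M → N` through the
universal property of `M → M^gp` (FrdI §0 p. 11). [cite: MochizukiFrdI2008, §0 p.11] -/
noncomputable def gpMap (f : M →* N) : Algebra.GrothendieckGroup M →* Algebra.GrothendieckGroup N :=
  Algebra.GrothendieckGroup.lift (Algebra.GrothendieckGroup.of.comp f)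

/-- Naturality of `M → M^gp`: `gpMap f ∘ of = of ∘ f`. [cite: MochizukiFrdI2008, §0 p.11] -/
theorem gpMap_comp_of (f : M →* N) :
    (gpMap f).comp Algebra.GrothendieckGroup.of = Algebra.GrothendieckGroup.of.comp f := by
  have h := Algebra.GrothendieckGroup.lift.symm_apply_apply (Algebra.GrothendieckGroup.of.comp f)
  rw [Algebra.GrothendieckGroup.lift_symm_apply] at h
  exact h

/-- `gpMap f (of a) = of (f a)`. [cite: MochizukiFrdI2008, §0 p.11] -/
@[simp] theorem gpMap_of (f : M →* N) (a : M) :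
    gpMap f (Algebra.GrothendieckGroup.of a) = Algebra.GrothendieckGroup.of (f a) :=
  DFunLike.congr_fun (gpMap_comp_of f) a

/-- `gpMap id = id`. [cite: MochizukiFrdI2008, §0 p.11] -/
theorem gpMap_id : gpMap (MonoidHom.id M) = MonoidHom.id _ := by
  apply Algebra.GrothendieckGroup.lift.symm.injective
  rw [Algebra.GrothendieckGroup.lift_symm_apply, Algebra.GrothendieckGroup.lift_symm_apply,
    gpMap_comp_of, MonoidHom.comp_id, MonoidHom.id_comp]

/-- `gpMap (g ∘ f) = gpMap g ∘ gpMap f`. [cite: MochizukiFrdI2008, §0 p.11] -/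
theorem gpMap_comp (f : M →* N) (g : N →* P) : gpMap (g.comp f) = (gpMap g).comp (gpMap f) := by
  apply Algebra.GrothendieckGroup.lift.symm.injective
  rw [Algebra.GrothendieckGroup.lift_symm_apply, Algebra.GrothendieckGroup.lift_symm_apply,
    gpMap_comp_of, MonoidHom.comp_assoc, gpMap_comp_of]
  conv_rhs => rw [← MonoidHom.comp_assoc, gpMap_comp_of]
  exact (MonoidHom.comp_assoc _ _ _).symm

end Groupification

/-! ### The functors `Φ^gp` and `Φ^pf` of a contravariant functor `Φ : D → Mon` -/

section Functors

variable {D : Type u} [Category.{v} D]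

/-- `Φ^pf : A ↦ Φ(A)^pf` (FrdI Def. 1.1 (ii)). [cite: MochizukiFrdI2008, Def. 1.1(ii)] -/
def perfectionFunctor (Φ : Dᵒᵖ ⥤ CommMonCat.{w}) : Dᵒᵖ ⥤ CommMonCat.{w} where
  obj A := CommMonCat.of (Perfection (Φ.obj A))
  map f := CommMonCat.ofHom (Perfection.map (Φ.map f).hom)
  map_id A := by
    refine CommMonCat.hom_ext ?_
    show Perfection.map (Φ.map (𝟙 A)).hom = MonoidHom.id _
    rw [Φ.map_id]
    exact Perfection.map_id
  map_comp f g := by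
    refine CommMonCat.hom_ext ?_
    show Perfection.map (Φ.map (f ≫ g)).hom = (Perfection.map (Φ.map g).hom).comp (Perfection.map (Φ.map f).hom)
    rw [Φ.map_comp]
    exact Perfection.map_comp _ _

/-- The natural transformation `Φ → Φ^pf` (FrdI §0 p. 11 / Def. 1.1 (ii)). [cite: MochizukiFrdI2008, Def. 1.1(ii)] -/
def toPerfectionFunctor (Φ : Dᵒᵖ ⥤ CommMonCat.{w}) : Φ ⟶ perfectionFunctor Φ where
  app A := CommMonCat.ofHom (Perfection.of (Φ.obj A))
  naturality _ _ f := CommMonCat.hom_ext (Perfection.map_comp_of (Φ.map f).hom).symm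

/-- `Φ^gp : A ↦ Φ(A)^gp` (FrdI Def. 1.1 (ii)). [cite: MochizukiFrdI2008, Def. 1.1(ii)] -/
noncomputable def groupificationFunctor (Φ : Dᵒᵖ ⥤ CommMonCat.{w}) : Dᵒᵖ ⥤ CommMonCat.{w} where
  obj A := CommMonCat.of (Algebra.GrothendieckGroup (Φ.obj A))
  map f := CommMonCat.ofHom (gpMap (Φ.map f).hom)
  map_id A := by
    refine CommMonCat.hom_ext ?_
    show gpMap (Φ.map (𝟙 A)).hom = MonoidHom.id _
    rw [Φ.map_id]
    exact gpMap_id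
  map_comp f g := by
    refine CommMonCat.hom_ext ?_
    show gpMap (Φ.map (f ≫ g)).hom = (gpMap (Φ.map g).hom).comp (gpMap (Φ.map f).hom)
    rw [Φ.map_comp]
    exact gpMap_comp _ _

/-- The natural transformation `Φ → Φ^gp` (FrdI §0 p. 11 / Def. 1.1 (ii)). [cite: MochizukiFrdI2008, Def. 1.1(ii)] -/
noncomputable def toGroupificationFunctor (Φ : Dᵒᵖ ⥤ CommMonCat.{w}) : Φ ⟶ groupificationFunctor Φ where
  app A := CommMonCat.ofHom (Algebra.GrothendieckGroup.of (M := Φ.obj A))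
  naturality _ _ f := CommMonCat.hom_ext (gpMap_comp_of (Φ.map f).hom).symm

end Functors

end Literature.AlgebraicGeometry.Frobenioids
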